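import Summits.CriticalPhenomena.SAWScalingLimit.Theorems.SAWTotalPositivityBoundaryTP2Defs
import Summits.CriticalPhenomena.SAWScalingLimit.Theorems.SAWTotalPositivityBoundaryTP2Kernel
import Summits.CriticalPhenomena.SAWScalingLimit.Theorems.SAWTotalPositivityBoundaryTP2Symmetry
import Summits.CriticalPhenomena.SAWScalingLimit.Theorems.SAWTotalPositivityBoundaryTP2RectReflect
import Summits.CriticalPhenomena.SAWScalingLimit.Theorems.SAWTotalPositivityBoundaryTP2LadderMinorCB
import Summits.CriticalPhenomena.SAWScalingLimit.Theorems.SAWTotalPositivityBoundaryTP2LadderBbttAdjacent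
import Summits.CriticalPhenomena.SAWScalingLimit.Theorems.SAWTotalPositivityBoundaryTP2LadderBbtt9Adjacent
import Summits.CriticalPhenomena.SAWScalingLimit.Theorems.EdgeOfPositivity.Negative.EdgeOfPositivityRectDomain
import HarnessLib

/-!
# Crux `BoundaryTP2` (stmt-CriticalPhenomena-7115), line `Sketch`: the dispatcher
`ladder_ccw_bbtt_adjacent` (two bottom + two top sites of a ladder, adjacent pairing)

On the ladder `R_L = discreteDomainGraph (rectDomain L 1) 1` (sites `{0..L} × {0,1}`) consider the
counter-clockwise boundary quadruple `q₁ = (c₁,0)`, `q₂ = (c₂,0)` (bottom row, `c₁ < c₂ ≤ L`),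
`q₃ = (d₁,1)`, `q₄ = (d₂,1)` (top row, visited right to left, `d₂ < d₁ ≤ L`), with ANY interleaving of
the bottom columns `{c₁, c₂}` with the top columns `{d₂, d₁}` (ties included), and `0 ≤ x ≤ 1/2`.
Then the crossing pairing weighs at most the adjacent one:

  `Z(q₁,q₃) Z(q₂,q₄) ≤ Z(q₁,q₂) Z(q₃,q₄)`,  `Z = pathKernel R_L x`.

Proof: a case analysis over landed lemmas, no new analysis.
* Bottoms left of tops (`c₂ ≤ d₂`): `stub_ladder_bbtt_adjacent` when `c₂ < d₂`, and the shared-column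
  lemma `stub_ladder_bbtt9_adjacent` for the tie `c₂ = d₂` (`ccwBbttAdj_left`).
* Tops left of bottoms (`d₁ ≤ c₁`): the previous case for the columns `L - c₂ < L - c₁ ≤ L - d₁ < L - d₂`,
  transported back by the column reflection `c ↦ L - c` of `stub_rect_reflect` (`ccwBbttAdj_right`).
* Otherwise `d₂ < c₂` and `c₁ < d₁`, so the split `{(d₂,1),(c₁,0)} | {(c₂,0),(d₁,1)}` is column-separated
  (`max d₂ c₁ < min c₂ d₁`) and the generic Cauchy–Binet minor `stub_ladder_minorCB` (crossing ≤ nested for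
  that split) is, after `pathKernel_comm`, exactly the claim.
-/

noncomputable section

namespace Summit.CriticalPhenomena.SAWScalingLimit.Theorems.BoundaryTP2

open Literature.Probability.LatticeModels Literature.Probability.RandomPlanarGeometry
open Summit.CriticalPhenomena.SAWScalingLimit.Theorems.EdgeOfPositivity.Negative
open scoped ENNReal

/-- Column reflection `c ↦ L - c` of a ladder kernel between two sites with natural-number columns
`i, i' ≤ L` (first conjunct of `stub_rect_reflect`, casts `↑(L - i) = ↑L - ↑i`). [folklore] -/
private theorem ccwBbttAdj_reflect (L : ℕ) (x : ℝ) {i i' : ℕ} (hi : i ≤ L) (hi' : i' ≤ L) (r s : ℤ) :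
    pathKernel (discreteDomainGraph (rectDomain L 1) 1) x (st (L - i : ℕ) r) (st (L - i' : ℕ) s) =
      pathKernel (discreteDomainGraph (rectDomain L 1) 1) x (st i r) (st i' s) := by
  rw [(stub_rect_reflect L 1 x i r i' s).1, Nat.cast_sub hi, Nat.cast_sub hi']

/-- Bottom sites left of the top sites, tie allowed: `c₁ < c₂ ≤ d₂ < d₁ ≤ L`, `0 ≤ x ≤ 1/2`:
`Z((c₁,0),(d₁,1)) Z((c₂,0),(d₂,1)) ≤ Z((c₁,0),(c₂,0)) Z((d₁,1),(d₂,1))`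
(`stub_ladder_bbtt9_adjacent` for `c₂ = d₂`, `stub_ladder_bbtt_adjacent` for `c₂ < d₂`). [folklore] -/
private theorem ccwBbttAdj_left (L : ℕ) {c₁ c₂ d₂ d₁ : ℕ} (h₁ : c₁ < c₂) (h₂ : c₂ ≤ d₂) (h₃ : d₂ < d₁)
    (h₄ : d₁ ≤ L) {x : ℝ} (hx0 : 0 ≤ x) (hx : x ≤ 1 / 2) :
    pathKernel (discreteDomainGraph (rectDomain L 1) 1) x (st c₁ 0) (st d₁ 1) *
        pathKernel (discreteDomainGraph (rectDomain L 1) 1) x (st c₂ 0) (st d₂ 1) ≤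
      pathKernel (discreteDomainGraph (rectDomain L 1) 1) x (st c₁ 0) (st c₂ 0) *
        pathKernel (discreteDomainGraph (rectDomain L 1) 1) x (st d₁ 1) (st d₂ 1) := by
  rcases h₂.eq_or_lt with rfl | h₂'
  · exact stub_ladder_bbtt9_adjacent L h₁ h₃ h₄ hx0 hx
  · exact stub_ladder_bbtt_adjacent L h₁ h₂' h₃ h₄ hx0 hx

/-- Top sites left of the bottom sites, tie allowed: `d₂ < d₁ ≤ c₁ < c₂ ≤ L`, `0 ≤ x ≤ 1/2`:
`Z((c₁,0),(d₁,1)) Z((c₂,0),(d₂,1)) ≤ Z((c₁,0),(c₂,0)) Z((d₁,1),(d₂,1))` — the mirror image of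
`ccwBbttAdj_left` under the column reflection `c ↦ L - c`. [folklore] -/
private theorem ccwBbttAdj_right (L : ℕ) {c₁ c₂ d₂ d₁ : ℕ} (h₁ : d₂ < d₁) (h₂ : d₁ ≤ c₁) (h₃ : c₁ < c₂)
    (h₄ : c₂ ≤ L) {x : ℝ} (hx0 : 0 ≤ x) (hx : x ≤ 1 / 2) :
    pathKernel (discreteDomainGraph (rectDomain L 1) 1) x (st c₁ 0) (st d₁ 1) *
        pathKernel (discreteDomainGraph (rectDomain L 1) 1) x (st c₂ 0) (st d₂ 1) ≤
      pathKernel (discreteDomainGraph (rectDomain L 1) 1) x (st c₁ 0) (st c₂ 0) *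
        pathKernel (discreteDomainGraph (rectDomain L 1) 1) x (st d₁ 1) (st d₂ 1) := by
  have hc₁ : c₁ ≤ L := by omega
  have hd₁ : d₁ ≤ L := by omega
  have hd₂ : d₂ ≤ L := by omega
  -- the reflected configuration `L - c₂ < L - c₁ ≤ L - d₁ < L - d₂ ≤ L` is of `ccwBbttAdj_left` type
  have h := ccwBbttAdj_left L (c₁ := L - c₂) (c₂ := L - c₁) (d₂ := L - d₁) (d₁ := L - d₂)
    (by omega) (by omega) (by omega) (by omega) hx0 hx
  rw [ccwBbttAdj_reflect L x h₄ hd₂ 0 1, ccwBbttAdj_reflect L x hc₁ hd₁ 0 1,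
    ccwBbttAdj_reflect L x h₄ hc₁ 0 0, ccwBbttAdj_reflect L x hd₂ hd₁ 1 1,
    pathKernel_comm _ _ (st c₂ 0) (st c₁ 0), pathKernel_comm _ _ (st d₂ 1) (st d₁ 1)] at h
  exact (mul_comm _ _).trans_le h

/-- **Dispatcher** (wave 7). Two bottom sites `c₁ < c₂ ≤ L` and two top sites `(d₁,1), (d₂,1)` with
`d₂ < d₁ ≤ L` (the counter-clockwise quadruple `(c₁,0),(c₂,0),(d₁,1),(d₂,1)`, ANY interleaving of the
columns, ties included), `0 ≤ x ≤ 1/2`, ADJACENT pairing: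
`Z((c₁,0),(d₁,1))·Z((c₂,0),(d₂,1)) ≤ Z((c₁,0),(c₂,0))·Z((d₁,1),(d₂,1))`. Column-separated interleavings
by `stub_ladder_minorCB`; bottoms left of tops by `stub_ladder_bbtt_adjacent` / `stub_ladder_bbtt9_adjacent`
(tie `d₂ = c₂`); tops left of bottoms by their mirror image under `c ↦ L - c` (`stub_rect_reflect`).
[folklore] -/
theorem ladder_ccw_bbtt_adjacent (L : ℕ) {c₁ c₂ d₁ d₂ : ℕ} (h₁₂ : c₁ < c₂) (h₂ : c₂ ≤ L) (hd : d₂ < d₁)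
    (hd₁ : d₁ ≤ L) {x : ℝ} (hx0 : 0 ≤ x) (hx : x ≤ 1 / 2) :
    pathKernel (discreteDomainGraph (rectDomain L 1) 1) x (st c₁ 0) (st d₁ 1) *
        pathKernel (discreteDomainGraph (rectDomain L 1) 1) x (st c₂ 0) (st d₂ 1) ≤
      pathKernel (discreteDomainGraph (rectDomain L 1) 1) x (st c₁ 0) (st c₂ 0) *
        pathKernel (discreteDomainGraph (rectDomain L 1) 1) x (st d₁ 1) (st d₂ 1) := by
  rcases le_or_gt c₂ d₂ with hcd | hcd
  · -- bottoms left of tops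
    exact ccwBbttAdj_left L h₁₂ hcd hd hd₁ hx0 hx
  rcases le_or_gt d₁ c₁ with hdc | hdc
  · -- tops left of bottoms
    exact ccwBbttAdj_right L hd hdc h₁₂ h₂ hx0 hx
  -- `d₂ < c₂`, `c₁ < d₁`: the split `{(d₂,1),(c₁,0)} | {(c₂,0),(d₁,1)}` is column-separated
  have hsep : max d₂ c₁ < min c₂ d₁ := max_lt (lt_min hcd hd) (lt_min h₁₂ hdc)
  have h := stub_ladder_minorCB L (i₁ := d₂) (i₂ := c₁) (j₁ := c₂) (j₂ := d₁) (r₁ := 1) (r₂ := 0)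
    (s₁ := 0) (s₂ := 1) (Or.inr rfl) (Or.inl rfl) (Or.inl rfl) (Or.inr rfl) hsep h₂ hd₁
    (Or.inl ⟨rfl, rfl⟩) (Or.inl ⟨rfl, rfl⟩) hx0 hx
  rw [pathKernel_comm _ _ (st d₂ 1) (st c₂ 0), pathKernel_comm _ _ (st d₂ 1) (st d₁ 1)] at h
  exact (mul_comm _ _).trans_le (h.trans_eq (mul_comm _ _))

end Summit.CriticalPhenomena.SAWScalingLimit.Theorems.BoundaryTP2
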